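import Summits.Ventures.LatticeQCDFlow.Exactness.Phi4MetropolisScan
import HarnessLib

/-!
# The random-scan Metropolis operator on UNBOUNDED observables of quadratic growth (the magnetisation class)

HONEST FRAMING: exact (Metropolis-corrected) sampling algorithms for lattice gauge theory;
figures of merit are autocorrelation/cost numbers at stated couplings and volumes; no
continuum-physics claim.  (SCALAR calibration rung S0-A: not a gauge result.)

Venture `LatticeQCDFlow` (cell pub-lqcd), topic `Exactness`; FANOUT row 2 (`s0-phi4`, LOCAL arm;
leftover (α): square-integrable, not only bounded, observables).  NEW WORK of the cell over row 2's
`metroSite` / `metroScan` (`Phi4LocalMetropolisExact`, `Phi4MetropolisScan`) and the moment bounds of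
`Scoring/SchwingerDysonPhi4GibbsMonomial`.  Nothing is cited as a fact.

## The class

`QuadObs f`: `f` measurable with `|f φ| ≤ B (1 + Σ_w |φ_w|)²` for some `B` — contains every
bounded observable, the magnetisation `M = Σ_x φ_x`, `M − c`, `|M|`, and the SQUARE of every
observable of linear growth (so `(M − ⟨M⟩)²`).  It is an admissible class for the abstract files
`ReversibleOperatorL2` / `ReversibleLocalityFloor` once the operator facts below are in place
(this file: integrability, stability, linearity; the companion `Phi4MetropolisScanEnvelopeDCT`:
reversibility and contraction by truncation + dominated convergence from the bounded case).

## What is proved (`Λ = Fin (n+1)`, coercive action, step density `ρ ≥ 0`, `∫ρ = 1`, vanishing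
outside `[−δ, δ]`, `δ ≥ 0`)

* `quartic_envelope_le`, **`integrable_quartic_envelope_mul_gibbsWeight`** —
  `(1 + Σ|φ_w|)⁴ ≤ 8 + 8(n+1)³ Σ_w φ_w⁴`, hence `(1 + Σ|φ_w|)⁴ e^{−S}` is integrable;
  `quadObs_integrable_mul_mul_gibbsWeight` ((int));
* `quadObs_const`, `quadObs_add_mul`, `quadObs_of_bddObs`, `quadObs_of_linear_growth`,
  `quadObs_sq_of_linear_growth` (class algebra);
* `sum_abs_update_le` — `Σ_w |(φ|φ_x:=t')_w| ≤ Σ_w |φ_w| + |t' − φ_x|`;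
  `envelope_update_sq_le` — on the window, `(1 + Σ|(φ|φ_x:=t')_w|)² ≤ (1+δ)²(1 + Σ|φ_w|)²`;
* `integrable_metroSite_integrand_quad`, **`abs_metroSite_le_quad`**
  (`|M_x f| ≤ B(1+δ)²(1 + Σ|φ_w|)²`), `quadObs_metroSite`, **`quadObs_metroScan`** ((stab));
  **`metroSite_add_mul_quad`**, **`metroScan_add_mul_quad`** ((lin)).

NOT CLAIMED here: reversibility / contraction on the class (companion file); step laws with
unbounded support (a Gaussian step would need moment hypotheses instead of the window).
-/

namespace Summit.Ventures.LatticeQCDFlow.Exactness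

open Real MeasureTheory Filter Finset
open Summit.Ventures.LatticeQCDFlow.Scoring

section Envelope

variable {n : ℕ}

/-- The admissible class of observables of QUADRATIC GROWTH on `ℝ^Λ`: measurable with
`|f φ| ≤ B (1 + Σ_w |φ_w|)²` for some `B` (contains `M = Σ_x φ_x` and `(M − c)²`).  A standard
growth class, no single source. [folklore] -/
@[folklore]
def QuadObs (f : (Fin (n + 1) → ℝ) → ℝ) : Prop :=
  Measurable f ∧ ∃ B : ℝ, ∀ φ, |f φ| ≤ B * (1 + ∑ w, |φ w|) ^ 2

/-- The envelope `1 + Σ_w |φ_w|` is at least `1`. -/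
theorem one_le_envelope (φ : Fin (n + 1) → ℝ) : 1 ≤ 1 + ∑ w, |φ w| :=
  le_add_of_nonneg_right (Finset.sum_nonneg fun w _ => abs_nonneg (φ w))

/-- The growth constant of a `QuadObs` bound is nonnegative. -/
theorem quadObs_const_nonneg {f : (Fin (n + 1) → ℝ) → ℝ} {B : ℝ}
    (hB : ∀ φ, |f φ| ≤ B * (1 + ∑ w, |φ w|) ^ 2) : 0 ≤ B := by
  have h := hB 0
  simp only [Pi.zero_apply, abs_zero, Finset.sum_const_zero, add_zero, one_pow, mul_one] at h
  exact (abs_nonneg _).trans h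

/-- Constants are in the class. -/
theorem quadObs_const (c : ℝ) : QuadObs (fun _ : Fin (n + 1) → ℝ => c) := by
  refine ⟨measurable_const, |c|, fun φ => ?_⟩
  have h1 := one_le_envelope φ
  calc |c| = |c| * 1 := (mul_one _).symm
    _ ≤ |c| * (1 + ∑ w, |φ w|) ^ 2 :=
        mul_le_mul_of_nonneg_left (by nlinarith) (abs_nonneg c)

/-- The class is closed under `f + c h`. -/
theorem quadObs_add_mul {f h : (Fin (n + 1) → ℝ) → ℝ} (hf : QuadObs f) (hh : QuadObs h) (c : ℝ) :
    QuadObs (fun φ => f φ + c * h φ) := by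
  obtain ⟨hfm, Bf, hfb⟩ := hf
  obtain ⟨hhm, Bh, hhb⟩ := hh
  refine ⟨hfm.add (measurable_const.mul hhm), Bf + |c| * Bh, fun φ => ?_⟩
  calc |f φ + c * h φ| ≤ |f φ| + |c| * |h φ| := by
        rw [← abs_mul]; exact abs_add_le _ _
    _ ≤ Bf * (1 + ∑ w, |φ w|) ^ 2 + |c| * (Bh * (1 + ∑ w, |φ w|) ^ 2) :=
        add_le_add (hfb φ) (mul_le_mul_of_nonneg_left (hhb φ) (abs_nonneg c))
    _ = (Bf + |c| * Bh) * (1 + ∑ w, |φ w|) ^ 2 := by ring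

/-- Bounded observables are in the class. -/
theorem quadObs_of_bddObs {f : (Fin (n + 1) → ℝ) → ℝ} (hf : BddObs f) : QuadObs f := by
  obtain ⟨hfm, B, hfb⟩ := hf
  refine ⟨hfm, |B|, fun φ => ?_⟩
  have h1 := one_le_envelope φ
  calc |f φ| ≤ B := hfb φ
    _ ≤ |B| * 1 := by rw [mul_one]; exact le_abs_self B
    _ ≤ |B| * (1 + ∑ w, |φ w|) ^ 2 := mul_le_mul_of_nonneg_left (by nlinarith) (abs_nonneg B)

/-- Observables of LINEAR growth (`|f| ≤ B(1 + Σ|φ_w|)`, e.g. `M − c`) are in the class. -/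
theorem quadObs_of_linear_growth {f : (Fin (n + 1) → ℝ) → ℝ} (hfm : Measurable f) {B : ℝ}
    (hfb : ∀ φ, |f φ| ≤ B * (1 + ∑ w, |φ w|)) : QuadObs f := by
  refine ⟨hfm, |B|, fun φ => ?_⟩
  have h1 := one_le_envelope φ
  calc |f φ| ≤ B * (1 + ∑ w, |φ w|) := hfb φ
    _ ≤ |B| * (1 + ∑ w, |φ w|) := mul_le_mul_of_nonneg_right (le_abs_self B) (by linarith)
    _ ≤ |B| * (1 + ∑ w, |φ w|) ^ 2 := mul_le_mul_of_nonneg_left (by nlinarith) (abs_nonneg B)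

/-- Squares of observables of linear growth (e.g. `(M − ⟨M⟩)²`) are in the class. -/
theorem quadObs_sq_of_linear_growth {f : (Fin (n + 1) → ℝ) → ℝ} (hfm : Measurable f) {B : ℝ}
    (hfb : ∀ φ, |f φ| ≤ B * (1 + ∑ w, |φ w|)) : QuadObs (fun φ => f φ ^ 2) := by
  refine ⟨hfm.pow_const 2, B ^ 2, fun φ => ?_⟩
  rw [abs_pow, ← mul_pow]
  exact pow_le_pow_left₀ (abs_nonneg _) (hfb φ) 2

/-- **The quartic envelope is dominated by even monomials**:
`(1 + Σ_w |φ_w|)⁴ ≤ 8 + 8 (n+1)³ Σ_w φ_w⁴`. -/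
theorem quartic_envelope_le (φ : Fin (n + 1) → ℝ) :
    (1 + ∑ w, |φ w|) ^ 4 ≤ 8 + 8 * ((n : ℝ) + 1) ^ 3 * ∑ w, φ w ^ 4 := by
  set S := ∑ w, |φ w| with hS
  have hS0 : 0 ≤ S := Finset.sum_nonneg fun w _ => abs_nonneg _
  -- `(1 + S)⁴ ≤ 8 (1 + S⁴)` (power mean), via the factorisation of the difference
  have h1 : (1 + S) ^ 4 ≤ 8 * (1 + S ^ 4) := by
    have e : 8 * (1 + S ^ 4) - (1 + S) ^ 4 = (S - 1) ^ 2 * (7 * S ^ 2 + 10 * S + 7) := by ring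
    nlinarith [mul_nonneg (sq_nonneg (S - 1)) (by positivity : (0 : ℝ) ≤ 7 * S ^ 2 + 10 * S + 7)]
  -- `S⁴ ≤ (n+1)³ Σ |φ_w|⁴` (Jensen for sums of powers)
  have h2 : S ^ 4 ≤ ((n : ℝ) + 1) ^ 3 * ∑ w, φ w ^ 4 := by
    have h := pow_sum_le_card_mul_sum_pow (s := (Finset.univ : Finset (Fin (n + 1))))
      (f := fun w => |φ w|) (fun w _ => abs_nonneg (φ w)) 3
    rw [Finset.card_univ, Fintype.card_fin] at h
    push_cast at h
    have e : ∑ w, |φ w| ^ (3 + 1) = ∑ w, φ w ^ 4 :=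
      Finset.sum_congr rfl fun w _ => by
        rw [show 3 + 1 = 4 by norm_num, pow_abs, abs_of_nonneg (by positivity : (0 : ℝ) ≤ φ w ^ 4)]
    rw [e] at h
    simpa [hS] using h
  nlinarith [h1, h2]

/-- **The quartic envelope is integrable against `e^{−S}`** (coercive action: all moments exist). -/
theorem integrable_quartic_envelope_mul_gibbsWeight {J : Fin (n + 1) → Fin (n + 1) → ℝ}
    {lam ε K : ℝ} (hε : 0 < ε)
    (hS : ∀ φ : Fin (n + 1) → ℝ, ε * ∑ w, φ w ^ 2 - K ≤ latticePhi4Action J lam φ) :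
    Integrable (fun φ : Fin (n + 1) → ℝ => (1 + ∑ w, |φ w|) ^ 4 * gibbsWeight J lam φ) := by
  have hw := integrable_gibbsWeight_of_coercive hε hS
  have hmon : ∀ w : Fin (n + 1),
      Integrable (fun φ : Fin (n + 1) → ℝ => φ w ^ 4 * φ w ^ 0 * gibbsWeight J lam φ) :=
    fun w => integrable_pow_mul_pow_mul_gibbsWeight_of_coercive hε hS w w 4 0
  have hsum : Integrable (fun φ : Fin (n + 1) → ℝ =>
      ∑ w, φ w ^ 4 * φ w ^ 0 * gibbsWeight J lam φ) :=
    integrable_finsetSum Finset.univ fun w _ => hmon w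
  have hbound : Integrable (fun φ : Fin (n + 1) → ℝ =>
      8 * gibbsWeight J lam φ + 8 * ((n : ℝ) + 1) ^ 3 * ∑ w, φ w ^ 4 * φ w ^ 0 * gibbsWeight J lam φ) :=
    (hw.const_mul 8).add (hsum.const_mul _)
  have hmeas : Measurable (fun φ : Fin (n + 1) → ℝ => (1 + ∑ w, |φ w|) ^ 4 * gibbsWeight J lam φ) :=
    ((measurable_const.add (Finset.measurable_sum _ fun w _ =>
      (measurable_pi_apply w).abs)).pow_const 4).mul (continuous_gibbsWeight J lam).measurable
  refine Integrable.mono' hbound hmeas.aestronglyMeasurable (Eventually.of_forall fun φ => ?_)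
  have hg := gibbsWeight_pos J lam φ
  have hE : 0 ≤ (1 + ∑ w, |φ w|) ^ 4 := by positivity
  rw [Real.norm_eq_abs, abs_of_nonneg (mul_nonneg hE hg.le)]
  have e : ∑ w, φ w ^ 4 * φ w ^ 0 * gibbsWeight J lam φ = (∑ w, φ w ^ 4) * gibbsWeight J lam φ := by
    rw [Finset.sum_mul]
    exact Finset.sum_congr rfl fun w _ => by rw [pow_zero, mul_one]
  rw [e]
  calc (1 + ∑ w, |φ w|) ^ 4 * gibbsWeight J lam φ
      ≤ (8 + 8 * ((n : ℝ) + 1) ^ 3 * ∑ w, φ w ^ 4) * gibbsWeight J lam φ :=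
        mul_le_mul_of_nonneg_right (quartic_envelope_le φ) hg.le
    _ = 8 * gibbsWeight J lam φ + 8 * ((n : ℝ) + 1) ^ 3 * ((∑ w, φ w ^ 4) * gibbsWeight J lam φ) := by
        ring

/-- **(int)** Products of two quadratic-growth observables are integrable against `e^{−S}`. -/
theorem quadObs_integrable_mul_mul_gibbsWeight {J : Fin (n + 1) → Fin (n + 1) → ℝ} {lam ε K : ℝ}
    (hε : 0 < ε) (hS : ∀ φ : Fin (n + 1) → ℝ, ε * ∑ w, φ w ^ 2 - K ≤ latticePhi4Action J lam φ)
    {f h : (Fin (n + 1) → ℝ) → ℝ} (hf : QuadObs f) (hh : QuadObs h) :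
    Integrable (fun φ => f φ * h φ * gibbsWeight J lam φ) := by
  obtain ⟨hfm, Bf, hfb⟩ := hf
  obtain ⟨hhm, Bh, hhb⟩ := hh
  have hBf := quadObs_const_nonneg hfb
  refine Integrable.mono' ((integrable_quartic_envelope_mul_gibbsWeight hε hS).const_mul (Bf * Bh))
    ((hfm.mul hhm).mul (continuous_gibbsWeight J lam).measurable).aestronglyMeasurable
    (Eventually.of_forall fun φ => ?_)
  have hg := gibbsWeight_pos J lam φ
  rw [Real.norm_eq_abs, abs_mul, abs_mul, abs_of_pos hg]
  have hE : 0 ≤ (1 + ∑ w, |φ w|) ^ 2 := by positivity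
  calc |f φ| * |h φ| * gibbsWeight J lam φ
      ≤ Bf * (1 + ∑ w, |φ w|) ^ 2 * (Bh * (1 + ∑ w, |φ w|) ^ 2) * gibbsWeight J lam φ := by
        refine mul_le_mul_of_nonneg_right ?_ hg.le
        exact mul_le_mul (hfb φ) (hhb φ) (abs_nonneg _) (mul_nonneg hBf hE)
    _ = Bf * Bh * ((1 + ∑ w, |φ w|) ^ 4 * gibbsWeight J lam φ) := by ring

/-- A single-site update moves the envelope by at most the increment:
`Σ_w |(φ|φ_x:=t')_w| ≤ Σ_w |φ_w| + |t' − φ_x|`. -/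
theorem sum_abs_update_le (φ : Fin (n + 1) → ℝ) (x : Fin (n + 1)) (t' : ℝ) :
    ∑ w, |Function.update φ x t' w| ≤ (∑ w, |φ w|) + |t' - φ x| := by
  have e1 : ∑ w, |Function.update φ x t' w| = |t'| + ∑ w ∈ Finset.univ \ {x}, |φ w| := by
    have e : ∀ w, |Function.update φ x t' w| = Function.update (fun k => |φ k|) x |t'| w :=
      fun w => Function.apply_update (fun _ a => |a|) φ x t' w
    rw [Finset.sum_congr rfl fun w _ => e w, Finset.sum_update_of_mem (Finset.mem_univ x)]
  have e2 : ∑ w, |φ w| = |φ x| + ∑ w ∈ Finset.univ \ {x}, |φ w| :=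
    Finset.sum_eq_add_sum_sdiff_singleton_of_mem (Finset.mem_univ x) fun k => |φ k|
  rw [e1, e2]
  have h := abs_sub_abs_le_abs_sub t' (φ x)
  linarith

/-- **On the window the squared envelope grows by at most `(1+δ)²`**: if `|t' − φ_x| ≤ δ` then
`(1 + Σ_w |(φ|φ_x:=t')_w|)² ≤ (1+δ)² (1 + Σ_w |φ_w|)²`. -/
theorem envelope_update_sq_le {δ : ℝ} (hδ : 0 ≤ δ) (φ : Fin (n + 1) → ℝ) (x : Fin (n + 1))
    {t' : ℝ} (ht : |t' - φ x| ≤ δ) :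
    (1 + ∑ w, |Function.update φ x t' w|) ^ 2 ≤ (1 + δ) ^ 2 * (1 + ∑ w, |φ w|) ^ 2 := by
  have hS0 : 0 ≤ ∑ w, |φ w| := Finset.sum_nonneg fun w _ => abs_nonneg _
  have hU0 : 0 ≤ 1 + ∑ w, |Function.update φ x t' w| := one_le_envelope _ |>.trans' (by norm_num)
  have h1 : 1 + ∑ w, |Function.update φ x t' w| ≤ (1 + δ) * (1 + ∑ w, |φ w|) := by
    have h := sum_abs_update_le φ x t'
    nlinarith [mul_nonneg hδ hS0]
  rw [← mul_pow]
  exact pow_le_pow_left₀ hU0 h1 2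

/-- The Metropolis integrand of a quadratic-growth observable is integrable in the proposal
variable (window step law), with the explicit envelope domination. -/
theorem integrable_metroSite_integrand_quad (J : Fin (n + 1) → Fin (n + 1) → ℝ) (lam : ℝ)
    {ρ : ℝ → ℝ} (hρ0 : ∀ u, 0 ≤ ρ u) (hρm : Measurable ρ) (hρi : Integrable ρ) {δ : ℝ} (hδ : 0 ≤ δ)
    (hρδ : ∀ u, δ < |u| → ρ u = 0) (x : Fin (n + 1)) {f : (Fin (n + 1) → ℝ) → ℝ}
    (hfm : Measurable f) {B : ℝ} (hfb : ∀ φ, |f φ| ≤ B * (1 + ∑ w, |φ w|) ^ 2)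
    (φ : Fin (n + 1) → ℝ) :
    Integrable (fun t' => (metroAccept J lam x φ t' * f (Function.update φ x t')
        + (1 - metroAccept J lam x φ t') * f φ) * ρ (t' - φ x))
      ∧ ∀ t', ‖(metroAccept J lam x φ t' * f (Function.update φ x t')
          + (1 - metroAccept J lam x φ t') * f φ) * ρ (t' - φ x)‖
        ≤ B * (1 + δ) ^ 2 * (1 + ∑ w, |φ w|) ^ 2 * ρ (t' - φ x) := by
  have hB := quadObs_const_nonneg hfb
  have hρt : Integrable (fun t' => ρ (t' - φ x)) := hρi.comp_sub_right (φ x)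
  have hw : Measurable (gibbsWeight J lam) := (continuous_gibbsWeight J lam).measurable
  have hupd : Measurable fun t' : ℝ => Function.update φ x t' := measurable_update φ
  have ha : Measurable fun t' => metroAccept J lam x φ t' := by
    unfold metroAccept
    exact measurable_const.min ((hw.comp hupd).div measurable_const)
  have hE1 : (1 + ∑ w, |φ w|) ^ 2 ≤ (1 + δ) ^ 2 * (1 + ∑ w, |φ w|) ^ 2 := by
    have h0 : 0 ≤ (1 + ∑ w, |φ w|) ^ 2 := by positivity
    have h1 : (1 : ℝ) ≤ (1 + δ) ^ 2 := by nlinarith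
    nlinarith
  have hbound : ∀ t', ‖(metroAccept J lam x φ t' * f (Function.update φ x t')
      + (1 - metroAccept J lam x φ t') * f φ) * ρ (t' - φ x)‖
        ≤ B * (1 + δ) ^ 2 * (1 + ∑ w, |φ w|) ^ 2 * ρ (t' - φ x) := by
    intro t'
    rw [Real.norm_eq_abs, abs_mul, abs_of_nonneg (hρ0 _)]
    by_cases hz : ρ (t' - φ x) = 0
    · simp [hz]
    · have ht : |t' - φ x| ≤ δ := by
        by_contra h
        exact hz (hρδ _ (lt_of_not_ge h))
      obtain ⟨ha0, ha1⟩ := metroAccept_nonneg_le J lam x φ t'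
      refine mul_le_mul_of_nonneg_right ?_ (hρ0 _)
      have hf1 : |f (Function.update φ x t')| ≤ B * (1 + δ) ^ 2 * (1 + ∑ w, |φ w|) ^ 2 := by
        calc |f (Function.update φ x t')| ≤ B * (1 + ∑ w, |Function.update φ x t' w|) ^ 2 := hfb _
          _ ≤ B * ((1 + δ) ^ 2 * (1 + ∑ w, |φ w|) ^ 2) :=
              mul_le_mul_of_nonneg_left (envelope_update_sq_le hδ φ x ht) hB
          _ = B * (1 + δ) ^ 2 * (1 + ∑ w, |φ w|) ^ 2 := by ring
      have hf2 : |f φ| ≤ B * (1 + δ) ^ 2 * (1 + ∑ w, |φ w|) ^ 2 := by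
        calc |f φ| ≤ B * (1 + ∑ w, |φ w|) ^ 2 := hfb φ
          _ ≤ B * ((1 + δ) ^ 2 * (1 + ∑ w, |φ w|) ^ 2) := mul_le_mul_of_nonneg_left hE1 hB
          _ = B * (1 + δ) ^ 2 * (1 + ∑ w, |φ w|) ^ 2 := by ring
      calc |metroAccept J lam x φ t' * f (Function.update φ x t') + (1 - metroAccept J lam x φ t') * f φ|
          ≤ |metroAccept J lam x φ t' * f (Function.update φ x t')|
              + |(1 - metroAccept J lam x φ t') * f φ| := abs_add_le _ _
        _ = metroAccept J lam x φ t' * |f (Function.update φ x t')|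
              + (1 - metroAccept J lam x φ t') * |f φ| := by
            rw [abs_mul, abs_mul, abs_of_nonneg ha0, abs_of_nonneg (sub_nonneg.2 ha1)]
        _ ≤ metroAccept J lam x φ t' * (B * (1 + δ) ^ 2 * (1 + ∑ w, |φ w|) ^ 2)
              + (1 - metroAccept J lam x φ t') * (B * (1 + δ) ^ 2 * (1 + ∑ w, |φ w|) ^ 2) :=
            add_le_add (mul_le_mul_of_nonneg_left hf1 ha0)
              (mul_le_mul_of_nonneg_left hf2 (sub_nonneg.2 ha1))
        _ = B * (1 + δ) ^ 2 * (1 + ∑ w, |φ w|) ^ 2 := by ring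
  refine ⟨Integrable.mono' (hρt.const_mul _)
    (((ha.mul (hfm.comp hupd)).add ((measurable_const.sub ha).mul measurable_const)).mul
      (hρm.comp (measurable_id.sub measurable_const))).aestronglyMeasurable
    (Eventually.of_forall hbound), hbound⟩

/-- **Envelope bound for the hit**: `|M_x f (φ)| ≤ B (1+δ)² (1 + Σ_w |φ_w|)²`. -/
theorem abs_metroSite_le_quad (J : Fin (n + 1) → Fin (n + 1) → ℝ) (lam : ℝ) {ρ : ℝ → ℝ}
    (hρ0 : ∀ u, 0 ≤ ρ u) (hρm : Measurable ρ) (hρi : Integrable ρ) (hρ1 : ∫ u, ρ u = 1)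
    {δ : ℝ} (hδ : 0 ≤ δ) (hρδ : ∀ u, δ < |u| → ρ u = 0) (x : Fin (n + 1))
    {f : (Fin (n + 1) → ℝ) → ℝ} (hfm : Measurable f) {B : ℝ}
    (hfb : ∀ φ, |f φ| ≤ B * (1 + ∑ w, |φ w|) ^ 2) (φ : Fin (n + 1) → ℝ) :
    |metroSite J lam ρ x f φ| ≤ B * (1 + δ) ^ 2 * (1 + ∑ w, |φ w|) ^ 2 := by
  obtain ⟨-, hbound⟩ := integrable_metroSite_integrand_quad J lam hρ0 hρm hρi hδ hρδ x hfm hfb φ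
  have hρt : Integrable (fun t' => ρ (t' - φ x)) := hρi.comp_sub_right (φ x)
  have h := norm_integral_le_of_norm_le (hρt.const_mul (B * (1 + δ) ^ 2 * (1 + ∑ w, |φ w|) ^ 2))
    (Eventually.of_forall hbound)
  rw [integral_const_mul, integral_sub_right_eq_self (μ := (volume : Measure ℝ)) ρ (φ x), hρ1,
    mul_one, Real.norm_eq_abs] at h
  exact h

/-- **(stab), one site**: the hit maps the class to itself. -/
theorem quadObs_metroSite (J : Fin (n + 1) → Fin (n + 1) → ℝ) (lam : ℝ) {ρ : ℝ → ℝ}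
    (hρ0 : ∀ u, 0 ≤ ρ u) (hρm : Measurable ρ) (hρi : Integrable ρ) (hρ1 : ∫ u, ρ u = 1)
    {δ : ℝ} (hδ : 0 ≤ δ) (hρδ : ∀ u, δ < |u| → ρ u = 0) (x : Fin (n + 1))
    {f : (Fin (n + 1) → ℝ) → ℝ} (hf : QuadObs f) : QuadObs (metroSite J lam ρ x f) := by
  obtain ⟨hfm, B, hfb⟩ := hf
  exact ⟨(measurable_metroSite J lam hρm x hfm).measurable, B * (1 + δ) ^ 2,
    fun φ => abs_metroSite_le_quad J lam hρ0 hρm hρi hρ1 hδ hρδ x hfm hfb φ⟩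

/-- **(stab)**: the random-site scan maps the class to itself. -/
theorem quadObs_metroScan (J : Fin (n + 1) → Fin (n + 1) → ℝ) (lam : ℝ) {ρ : ℝ → ℝ}
    (hρ0 : ∀ u, 0 ≤ ρ u) (hρm : Measurable ρ) (hρi : Integrable ρ) (hρ1 : ∫ u, ρ u = 1)
    {δ : ℝ} (hδ : 0 ≤ δ) (hρδ : ∀ u, δ < |u| → ρ u = 0)
    {f : (Fin (n + 1) → ℝ) → ℝ} (hf : QuadObs f) : QuadObs (metroScan J lam ρ f) := by
  obtain ⟨hfm, B, hfb⟩ := hf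
  have hn : (0 : ℝ) < (n : ℝ) + 1 := by positivity
  refine ⟨?_, B * (1 + δ) ^ 2, fun φ => ?_⟩
  · unfold metroScan
    exact (Finset.measurable_sum _ fun x _ =>
      (measurable_metroSite J lam hρm x hfm).measurable).div_const _
  · unfold metroScan
    rw [abs_div, abs_of_pos hn, div_le_iff₀ hn]
    calc |∑ x, metroSite J lam ρ x f φ| ≤ ∑ x, |metroSite J lam ρ x f φ| :=
          Finset.abs_sum_le_sum_abs _ _
      _ ≤ ∑ _x : Fin (n + 1), B * (1 + δ) ^ 2 * (1 + ∑ w, |φ w|) ^ 2 :=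
          Finset.sum_le_sum fun x _ => abs_metroSite_le_quad J lam hρ0 hρm hρi hρ1 hδ hρδ x hfm hfb φ
      _ = B * (1 + δ) ^ 2 * (1 + ∑ w, |φ w|) ^ 2 * ((n : ℝ) + 1) := by
          rw [Finset.sum_const, Finset.card_univ, Fintype.card_fin, nsmul_eq_mul]
          push_cast
          ring

/-- **(lin), one site**: the hit is linear on the class (window step law). -/
theorem metroSite_add_mul_quad (J : Fin (n + 1) → Fin (n + 1) → ℝ) (lam : ℝ) {ρ : ℝ → ℝ}
    (hρ0 : ∀ u, 0 ≤ ρ u) (hρm : Measurable ρ) (hρi : Integrable ρ) {δ : ℝ} (hδ : 0 ≤ δ)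
    (hρδ : ∀ u, δ < |u| → ρ u = 0) (x : Fin (n + 1)) {f h : (Fin (n + 1) → ℝ) → ℝ}
    (hf : QuadObs f) (hh : QuadObs h) (c : ℝ) (φ : Fin (n + 1) → ℝ) :
    metroSite J lam ρ x (fun s => f s + c * h s) φ
      = metroSite J lam ρ x f φ + c * metroSite J lam ρ x h φ := by
  obtain ⟨hfm, Bf, hfb⟩ := hf
  obtain ⟨hhm, Bh, hhb⟩ := hh
  unfold metroSite
  have hIf := (integrable_metroSite_integrand_quad J lam hρ0 hρm hρi hδ hρδ x hfm hfb φ).1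
  have hIh := (integrable_metroSite_integrand_quad J lam hρ0 hρm hρi hδ hρδ x hhm hhb φ).1
  have e : ∀ t', (metroAccept J lam x φ t' * (f (Function.update φ x t') + c * h (Function.update φ x t'))
      + (1 - metroAccept J lam x φ t') * (f φ + c * h φ)) * ρ (t' - φ x)
      = (metroAccept J lam x φ t' * f (Function.update φ x t')
          + (1 - metroAccept J lam x φ t') * f φ) * ρ (t' - φ x)
        + c * ((metroAccept J lam x φ t' * h (Function.update φ x t')
          + (1 - metroAccept J lam x φ t') * h φ) * ρ (t' - φ x)) := fun t' => by ring
  simp_rw [e]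
  rw [integral_add hIf (hIh.const_mul c), integral_const_mul]

/-- **(lin)**: the random-site scan is linear on the class. -/
theorem metroScan_add_mul_quad (J : Fin (n + 1) → Fin (n + 1) → ℝ) (lam : ℝ) {ρ : ℝ → ℝ}
    (hρ0 : ∀ u, 0 ≤ ρ u) (hρm : Measurable ρ) (hρi : Integrable ρ) {δ : ℝ} (hδ : 0 ≤ δ)
    (hρδ : ∀ u, δ < |u| → ρ u = 0) {f h : (Fin (n + 1) → ℝ) → ℝ}
    (hf : QuadObs f) (hh : QuadObs h) (c : ℝ) (φ : Fin (n + 1) → ℝ) :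
    metroScan J lam ρ (fun s => f s + c * h s) φ = metroScan J lam ρ f φ + c * metroScan J lam ρ h φ := by
  unfold metroScan
  rw [Finset.sum_congr rfl fun x _ => metroSite_add_mul_quad J lam hρ0 hρm hρi hδ hρδ x hf hh c φ,
    Finset.sum_add_distrib, ← Finset.mul_sum, add_div, mul_div_assoc]

end Envelope

end Summit.Ventures.LatticeQCDFlow.Exactness
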